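import Literature.AnabelianGeometry.SemiGraphs.TemperedDecompositionSingleVertex
import Literature.AnabelianGeometry.SemiGraphs.TemperedCompactInVerticialFin
import HarnessLib

/-!
# [IUTchI] Prop. 2.2, third inclusion: `Π^tp_ℍ ⊆ Π^tp_𝔾` is commensurably terminal — the TEMPERED route

Mochizuki, *Inter-universal Teichmüller theory I*, §2, Prop. 2.2 p. 45 ("Commensurators of Decomposition
Subgroups Associated to Sub-semi-graphs"): "`Π̂_ℍ` (respectively, `Π^tp_ℍ`) is commensurably terminal in
`Π̂_𝔾` (respectively, `Π̂_𝔾` [hence, also in `Π^tp_𝔾`])" [cite: Mochizuki2012, IUTchI Prop 2.2 p.45]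
[claim: Mochizuki2012, status: disputed]; the decomposition groups `Π^tp_ℍ ⊆ Π^tp_𝔾` of §2 p. 44
l. 39–44 ("natural commutative diagram … of [outer] inclusions … of topological groups").  Mochizuki,
*Semi-graphs of anabelioids*, Publ. RIMS **42** (2006), Thm. 3.7 (i)–(iii) pp. 40–41
[cite: MochizukiSemiAnbd2006, Thm 3.7 pp.40-41].

PROOF-ONLY file (abc-iut cell, layer L3, row «DECOMP-P2» = GAP row G-w5d028-2 sub-row (γ-1) of the L5
cone §2 block, consumer: the exact residual #1 «`C_{π₁^temp}(TpH) = TpH`» of cone node IUTchI:Cor2.3(i)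
at a general connected `ℍ`; seat abc-iut-w4-d052 gen 5).  It attacks the NAMED TARGET
`TemperedPiChart.DecompSubgroupsCommensurablyTerminal c ℍ` of `TemperedDecompositionSubgroups.lean` for a
GENERAL sub-semi-graph `ℍ` by the tempered argument that the tree's single-vertex theorem
`commensurator_eq_of_mem_verticialSubgroups` / `decompSubgroupsCommensurablyTerminal_singleVertex`
generalises — NOT by the printed profinite detour (Prop. 2.1 for `ℍ`, `C_{Π̂_𝔾}(Π̂_ℍ) = Π̂_ℍ`):

* Lemma A `IsDecompHom.isVerticialHom_comp` / `map_mem_verticialSubgroups`: a decomposition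
  homomorphism `φ : π₁^temp(𝒢_ℍ) → π₁^temp(𝒢)` carries verticial homomorphisms (subgroups) of `𝒢_ℍ` at a
  vertex `v ∈ ℍ` to verticial homomorphisms (subgroups) of `𝒢` at `v` (`covRestrict ⋙ restrictV =
  restrictV` is definitional);
* `isCommensurablyTerminal_range_of_isCompact_comap` — the argument.  WHERE THE EDGES OF `ℍ` ENTER:
  exactly once, through [SemiAnbd] Thm. 3.7 (iii) AT `𝒢_ℍ` (`CompactInVerticialAt (𝒢.restrict ℍ)`,
  hypothesis `hCIV`; a THEOREM for finite `ℍ`, `compactInVerticialFin_holds`): a compact subgroup of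
  `π₁^temp(𝒢_ℍ)` lies in a verticial subgroup of an `ℍ`-vertex.  The rest is Thm. 3.7 (ii) for `𝒢`
  (`verticialDistinct_holds`, PROVED in the tree: distinct parametrisation data ⇒ infinite relative
  index), Thm. 3.7 (i) for `𝒢_ℍ` (`verticialInjective_holds`, PROVED: verticial subgroups exist) and "one
  conjugacy class per vertex" (`exists_conj_of_mem_verticialSubgroups`).  For `g ∈ C(D)`, `D = φ(Π′)`,
  `H_v = φ(H′_v)` verticial at `v ∈ ℍ`: `K := gH_vg⁻¹` meets `D` with finite index; `φ⁻¹(K)` is compact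
  (HYPOTHESIS `hlift`, compact lifting), hence inside a verticial `H′_w` of `π₁^temp(𝒢_ℍ)`; so
  `K ∩ D ≤ φ(H′_w)`, verticial at `w`; finite index forces `w = v` and `K = dH_vd⁻¹` with
  `d = φ(s) ∈ D`; hence `d⁻¹g ∈ N(H_v) = H_v ≤ D`;
* the compact lifting `hlift` holds as soon as `φ` INDUCES the topology of `π₁^temp(𝒢_ℍ)` — print's
  "inclusions … of topological groups" p. 44: for TEMPERED groups such a `φ` is injective with CLOSED
  range (`IsTempered.injective_of_isInducing`, `IsTempered.isClosed_range_of_isInducing` — completeness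
  `IsTempered.complete` of `π₁^temp(𝒢_ℍ)` + separatedness of `π₁^temp(𝒢)`), so a closed embedding
  (`IsTempered.isCompact_comap_of_isInducing`);
* assembly: `decompSubgroupsCommensurablyTerminal_of_isInducing` (+ `_of_finite` for finite `ℍ`), and
  `isClosed_of_mem_decompSubgroups_of_isInducing` (every decomposition subgroup is then CLOSED — the
  tempered-topology part of the (P1) target of G-w5d028-2).

HONEST SCOPE.  What is NOT proved here is the embedding hypothesis `hind : IsInducing φ` (equivalently:
every pointed connected tempered covering of `𝒢_ℍ` is dominated by the pointed component of `S|_ℍ` for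
some tempered covering `S` of `𝒢` — the tempered covering-extension property; its finite-étale half is
[SemiAnbd] Prop. 2.5 (i), in the tree on the `SemiGraphOfAnabelioids` side as `piHToPi_injective`).  It is
a hypothesis-shaped explicit binder (row «DECOMP-EMB» of the cell), not a new named fact; nothing here is a
`def`.  Theorems only; no instance, no notation; nothing here takes a side on [IUTchIII] Cor. 3.12.
-/

namespace Literature.AnabelianGeometry.SemiGraphs

open CategoryTheory Topology
open scoped Pointwise
open Literature.AnabelianGeometry.AbsoluteAnabelian (IsCommensurablyTerminal)

universe u

namespace ProfiniteSemiGraph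

variable {𝒢 : ProfiniteSemiGraph.{u}}

namespace TemperedPiChart

variable {c : TemperedPiChart 𝒢} {H : 𝒢.graph.Subgraph}

/-! ### Lemma A: decomposition homomorphisms carry verticial homomorphisms of `𝒢_ℍ` to verticial
homomorphisms of `𝒢` -/

/-- **A decomposition homomorphism `φ : π₁^temp(𝒢_ℍ) → π₁^temp(𝒢)` carries the verticial homomorphisms
of `𝒢_ℍ` at a vertex `v` of `ℍ` to verticial homomorphisms of `𝒢` at `v`**: `B^temp(φ ∘ ψ) =
B^temp(ψ) ∘ B^temp(φ) ≅ (S ↦ (S|_ℍ)_v) = (S ↦ S_v)` read through the charts (restriction to `ℍ` followed by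
restriction to the vertex `v ∈ ℍ` IS restriction to `v`, `covRestrict_comp_restrictV`).
[cite: MochizukiSemiAnbd2006, Thm 3.7(i) p.40] -/
theorem IsDecompHom.isVerticialHom_comp {c' : TemperedPiChart (𝒢.restrict H)} {φ : c'.G →ₜ* c.G}
    (h : c.IsDecompHom H c' φ) {v : H.toSemiGraph.Vertex} {ψ : (𝒢.restrict H).Gv v →ₜ* c'.G}
    (hψ : IsVerticialHom c' v ψ) : IsVerticialHom c v.1 (φ.comp ψ) := by
  obtain ⟨e⟩ := h
  obtain ⟨k⟩ := hψ
  refine ⟨?_ ≪≫ Functor.isoWhiskerLeft (BTemp.res φ) k⟩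
  -- `c.equiv⁻¹ ⋙ ι ⋙ (S ↦ S_v) = (c.equiv⁻¹ ⋙ restrict) ⋙ (ι ⋙ (S ↦ S_v))` (rfl), insert the unit of `c'`
  exact (Functor.isoWhiskerLeft (c.equiv.inverse ⋙ 𝒢.btempRestrict H)
      ((Functor.leftUnitor _).symm ≪≫ Functor.isoWhiskerRight c'.equiv.unitIso
        (ObjectProperty.ι _ ⋙ restrictV (𝒢.restrict H) v)) :
      c.equiv.inverse ⋙ ObjectProperty.ι _ ⋙ restrictV 𝒢 v.1 ≅
        (c.equiv.inverse ⋙ 𝒢.btempRestrict H) ⋙ ((c'.equiv.functor ⋙ c'.equiv.inverse) ⋙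
          (ObjectProperty.ι _ ⋙ restrictV (𝒢.restrict H) v))) ≪≫
    (Functor.isoWhiskerRight e (c'.equiv.inverse ⋙ ObjectProperty.ι _ ⋙ restrictV (𝒢.restrict H) v) :
      (c.equiv.inverse ⋙ 𝒢.btempRestrict H ⋙ c'.equiv.functor) ⋙
          (c'.equiv.inverse ⋙ ObjectProperty.ι _ ⋙ restrictV (𝒢.restrict H) v) ≅
        BTemp.res φ ⋙ (c'.equiv.inverse ⋙ ObjectProperty.ι _ ⋙ restrictV (𝒢.restrict H) v))

/-- Hence **`φ(Π'_v)` is a verticial subgroup of `π₁^temp(𝒢)` at `v`** for every verticial subgroup `Π'_v`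
of `π₁^temp(𝒢_ℍ)` at a vertex `v` of `ℍ`. [cite: MochizukiSemiAnbd2006, Thm 3.7(i) p.40] -/
theorem IsDecompHom.map_mem_verticialSubgroups {c' : TemperedPiChart (𝒢.restrict H)}
    {φ : c'.G →ₜ* c.G} (h : c.IsDecompHom H c' φ) {v : H.toSemiGraph.Vertex} {H' : Subgroup c'.G}
    (hH' : H' ∈ verticialSubgroups c' v) :
    H'.map φ.toMonoidHom ∈ verticialSubgroups c v.1 := by
  obtain ⟨ψ, hψ, rfl⟩ := hH'
  exact ⟨φ.comp ψ, h.isVerticialHom_comp hψ, by rw [MonoidHom.map_range]; rfl⟩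

/-! ### Transport of conjugation along `φ` -/

/-- `φ(s·H′·s⁻¹) = φ(s)·φ(H′)·φ(s)⁻¹`. [folklore] -/
private theorem map_conj_map_along {Γ Γ' : Type*} [Group Γ] [Group Γ'] (f : Γ' →* Γ) (H' : Subgroup Γ')
    (s : Γ') : (H'.map (MulAut.conj s).toMonoidHom).map f =
      (H'.map f).map (MulAut.conj (f s)).toMonoidHom := by
  rw [Subgroup.map_map, Subgroup.map_map]
  congr 1
  ext x
  simp

/-! ### The tempered argument: `C_{Π^tp_𝔾}(Π^tp_ℍ) = Π^tp_ℍ` -/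

/-- **The range of a decomposition homomorphism is commensurably terminal — tempered route, modulo
compact lifting.**  Inputs: [SemiAnbd] Thm. 3.7 (ii) for `𝒢` (`verticialDistinct_holds`, PROVED in the
tree), Thm. 3.7 (i) for `𝒢_ℍ` (`verticialInjective_holds`, PROVED: a verticial subgroup of `π₁^temp(𝒢_ℍ)`
exists at a vertex of `ℍ`), Thm. 3.7 (iii) AT `𝒢_ℍ` (`CompactInVerticialAt (𝒢.restrict ℍ)` — the hypothesis
`hCIV`; PROVED for finite `ℍ`, `compactInVerticialFin_holds`) — this is the ONLY place where the edges of
`ℍ` enter: a compact subgroup of `Π^tp_ℍ` lies in a verticial subgroup of an `ℍ`-vertex — and the compact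
lifting property `hlift` of the decomposition homomorphism `φ` (`φ⁻¹(K)` compact for compact `K`; it holds
when `φ` is a topological embedding, `isCompact_comap_of_isInducing`).  Argument: for `g ∈ C(D)`,
`D = φ(Π′)`, and a verticial `H_v = φ(H′_v) ≤ D` at `v ∈ ℍ`, the verticial subgroup `K = gH_vg⁻¹` meets `D`
with finite index; `φ⁻¹(K)` is compact, so lies in a verticial `H′_w` of `π₁^temp(𝒢_ℍ)`, whence
`K ∩ D ≤ H_w := φ(H′_w)`, verticial at `w`; finite index forces `w = v` (Thm. 3.7 (ii), distinct vertices)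
and `K = dH_vd⁻¹` with `d = φ(s) ∈ D` (one conjugacy class per vertex in `π₁^temp(𝒢_ℍ)` + Thm. 3.7 (ii),
same vertex), so `d⁻¹g ∈ N(H_v) = H_v ≤ D`. [cite: Mochizuki2012, IUTchI Prop 2.2 p.45] -/
theorem isCommensurablyTerminal_range_of_isCompact_comap (h37 : 𝒢.Thm37Hypotheses)
    (h37H : (𝒢.restrict H).Thm37Hypotheses) (hCIV : CompactInVerticialAt (𝒢.restrict H))
    {c' : TemperedPiChart (𝒢.restrict H)} {φ : c'.G →ₜ* c.G} (hφ : c.IsDecompHom H c' φ)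
    (hlift : ∀ K : Subgroup c.G, IsCompact (K : Set c.G) →
      IsCompact ((K.comap φ.toMonoidHom : Subgroup c'.G) : Set c'.G)) :
    IsCommensurablyTerminal φ.toMonoidHom.range := by
  classical
  haveI := c.isTopologicalGroup
  set D := φ.toMonoidHom.range with hD_def
  -- a vertex `v` of `ℍ` and a verticial subgroup `H′_v` of `π₁^temp(𝒢_ℍ)` at `v` (Thm 3.7 (i) for `𝒢_ℍ`)
  obtain ⟨v⟩ := h37H.hasVertex
  obtain ⟨H'v, hH'v⟩ := (verticialInjective_holds (𝒢.restrict H) h37H c' v).1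
  -- its image `H_v = φ(H′_v)` is verticial at `v` for `𝒢` (Lemma A) and lies in `D`
  have hHv : H'v.map φ.toMonoidHom ∈ verticialSubgroups c v.1 := hφ.map_mem_verticialSubgroups hH'v
  set Hv := H'v.map φ.toMonoidHom with hHv_def
  have hHvD : Hv ≤ D := by
    rintro _ ⟨x, -, rfl⟩
    exact ⟨x, rfl⟩
  have hVD := verticialDistinct_holds 𝒢 h37 c
  refine ⟨le_antisymm (fun g hg => ?_) (le_commensurator_self D)⟩
  rw [Subgroup.Commensurable.commensurator_mem_iff] at hg
  -- `K := g H_v g⁻¹`, verticial at `v`, contained in `gDg⁻¹`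
  set K := Hv.map (MulAut.conj g).toMonoidHom with hK_def
  have hKvert : K ∈ verticialSubgroups c v.1 := conj_mem_verticialSubgroups c hHv g
  have hKle : K ≤ ConjAct.toConjAct g • D := by
    change Hv.map (MulAut.conj g).toMonoidHom ≤ D.map (MulAut.conj g).toMonoidHom
    exact Subgroup.map_mono hHvD
  -- `D ∩ K` has finite index in `K` (commensurability)
  have hDK : D.relIndex K ≠ 0 := fun h0 =>
    hg.2 (Subgroup.relIndex_eq_zero_of_le_right hKle h0)
  -- compact lifting: `φ⁻¹(K)` is compact, hence inside a verticial subgroup `H′_w` of `π₁^temp(𝒢_ℍ)`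
  have hKc : IsCompact (K : Set c.G) := isCompact_of_mem_verticialSubgroups c hKvert
  obtain ⟨⟨w, H'w, hH'w, hM'le⟩, -⟩ := hCIV h37H c' (K.comap φ.toMonoidHom) (hlift K hKc)
  -- `H_w := φ(H′_w)` is verticial at `w` for `𝒢` and contains `D ∩ K`
  have hHw : H'w.map φ.toMonoidHom ∈ verticialSubgroups c w.1 := hφ.map_mem_verticialSubgroups hH'w
  have hDKle : D ⊓ K ≤ H'w.map φ.toMonoidHom := by
    rintro x ⟨⟨y, rfl⟩, hyK⟩
    exact ⟨y, hM'le (Subgroup.mem_comap.mpr hyK), rfl⟩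
  have hHwK : (H'w.map φ.toMonoidHom).relIndex K ≠ 0 := by
    intro h0
    apply hDK
    have hdvd := Subgroup.relIndex_dvd_of_le_left (L := K) hDKle
    rw [Subgroup.inf_relIndex_right, h0, zero_dvd_iff] at hdvd
    exact hdvd
  -- Thm 3.7 (ii), distinct vertices: `w = v`
  have hwv : v = w := by
    by_contra hne
    exact hHwK (hVD.1 v.1 w.1 K _ hKvert hHw fun h => hne (Subtype.ext h))
  subst hwv
  -- `H′_w`, `H′_v` are verticial of `π₁^temp(𝒢_ℍ)` at the same vertex: conjugate by some `s ∈ Π′`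
  obtain ⟨s, hs⟩ := exists_conj_of_mem_verticialSubgroups c' hH'v hH'w
  have hHw_eq : H'w.map φ.toMonoidHom = Hv.map (MulAut.conj (φ s)).toMonoidHom := by
    rw [hs, hHv_def]
    exact map_conj_map_along φ.toMonoidHom H'v s
  -- Thm 3.7 (ii), same vertex: `g⁻¹ φ(s) ∈ H_v`
  have hgd : g⁻¹ * φ s ∈ Hv := by
    by_contra hnot
    apply hHwK
    rw [hHw_eq]
    exact hVD.2 v.1 Hv hHv g (φ s) hnot
  -- conclude: `g = φ(s) · (φ(s)⁻¹ g) ∈ D`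
  have h1 : (φ s)⁻¹ * g ∈ D := hHvD (by simpa using Hv.inv_mem hgd)
  have h2 : φ s ∈ D := ⟨s, rfl⟩
  simpa using D.mul_mem h2 h1

/-- **[IUTchI] Prop. 2.2, third inclusion, at the genuine carrier — modulo compact lifting**: under the
hypotheses of `isCommensurablyTerminal_range_of_isCompact_comap`, EVERY decomposition subgroup of `ℍ`
is commensurably terminal in `π₁^temp(𝒢)` (they form one conjugacy class,
`decompSubgroupsCommensurablyTerminal_of_one`). [cite: Mochizuki2012, IUTchI Prop 2.2 p.45] -/
theorem decompSubgroupsCommensurablyTerminal_of_isCompact_comap (h37 : 𝒢.Thm37Hypotheses)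
    (h37H : (𝒢.restrict H).Thm37Hypotheses) (hCIV : CompactInVerticialAt (𝒢.restrict H))
    {c' : TemperedPiChart (𝒢.restrict H)} {φ : c'.G →ₜ* c.G} (hφ : c.IsDecompHom H c' φ)
    (hlift : ∀ K : Subgroup c.G, IsCompact (K : Set c.G) →
      IsCompact ((K.comap φ.toMonoidHom : Subgroup c'.G) : Set c'.G)) :
    c.DecompSubgroupsCommensurablyTerminal H :=
  decompSubgroupsCommensurablyTerminal_of_one hφ.range_mem
    (isCommensurablyTerminal_range_of_isCompact_comap h37 h37H hCIV hφ hlift)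

end TemperedPiChart

end ProfiniteSemiGraph

/-! ### Tempered groups: a homomorphism inducing the topology is a closed embedding -/

section TemperedEmbedding

variable {Γ Γ' : Type*} [Group Γ] [TopologicalSpace Γ] [IsTopologicalGroup Γ]
  [Group Γ'] [TopologicalSpace Γ']

omit [IsTopologicalGroup Γ] in
/-- A continuous homomorphism out of a tempered group that INDUCES its topology is injective (tempered
groups are separated by their open normal subgroups). [cite: MochizukiSemiAnbd2006, Def 3.1(i) p.33] -/
theorem IsTempered.injective_of_isInducing (hΓ' : IsTempered Γ') (φ : Γ' →ₜ* Γ)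
    (hind : Topology.IsInducing φ) : Function.Injective φ := by
  refine (injective_iff_map_eq_one φ).mpr fun x hx => ?_
  by_contra hx1
  obtain ⟨N, hxN⟩ := hΓ'.separated x hx1
  obtain ⟨V, -, hVN⟩ := hind.isOpen_iff.mp N.toOpenSubgroup.isOpen
  have h1 : (1 : Γ') ∈ φ ⁻¹' V := by rw [hVN]; exact one_mem N
  have hxV : x ∈ φ ⁻¹' V := by
    show φ x ∈ V
    rw [hx, ← map_one φ]
    exact h1
  rw [hVN] at hxV
  exact hxN hxV

/-- **A continuous homomorphism `φ : Γ′ → Γ` between TEMPERED groups that induces the topology of `Γ′` has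
CLOSED range.**  Proof: for `x` in the closure of the range, the cosets `{y N′ : φ(y) ∈ x·U}` (`U` an open
normal subgroup of `Γ` with `φ⁻¹(U) ⊆ N′`) form a compatible family over the open normal subgroups `N′`
of `Γ′`; by completeness of `Γ′` (`IsTempered.complete`) it comes from some `g`, and `φ(g) = x` because
`Γ` is separated. [cite: MochizukiSemiAnbd2006, Def 3.1(i) p.33] -/
theorem IsTempered.isClosed_range_of_isInducing (hΓ : IsTempered Γ) (hΓ' : IsTempered Γ')
    (φ : Γ' →ₜ* Γ) (hind : Topology.IsInducing φ) : IsClosed (Set.range φ) := by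
  classical
  refine isClosed_of_closure_subset fun x hx => ?_
  -- (E) every open normal subgroup of `Γ′` contains `φ⁻¹(U)` for an open normal subgroup `U` of `Γ`
  have hE : ∀ N' : OpenNormalSubgroup Γ', ∃ U : OpenNormalSubgroup Γ, φ ⁻¹' (U : Set Γ) ⊆ N' := by
    intro N'
    obtain ⟨V, hVo, hVN⟩ := hind.isOpen_iff.mp N'.toOpenSubgroup.isOpen
    have h1V : (1 : Γ) ∈ V := by
      have : (1 : Γ') ∈ φ ⁻¹' V := by rw [hVN]; exact one_mem N'
      simpa using this
    obtain ⟨U, -, hUV⟩ := hΓ.basis V (hVo.mem_nhds h1V)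
    refine ⟨U, fun z hz => ?_⟩
    have hzV : z ∈ φ ⁻¹' V := hUV hz
    rw [hVN] at hzV
    exact hzV
  -- (P) every translate `x·U` meets the range
  have hP : ∀ U : OpenNormalSubgroup Γ, ∃ y : Γ', x⁻¹ * φ y ∈ U := by
    intro U
    have hopen : IsOpen ((fun z => x * z) '' (U : Set Γ)) :=
      isOpenMap_mul_left x _ U.toOpenSubgroup.isOpen
    obtain ⟨z, ⟨u, hu, rfl⟩, ⟨y, hy⟩⟩ := mem_closure_iff.mp hx _ hopen ⟨1, one_mem U, mul_one x⟩
    exact ⟨y, by rw [hy]; simpa using hu⟩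
  choose U hU using hE
  choose y hy using hP
  -- (W) the coset `y N′` does not depend on the choices `(U, y)`
  have hW : ∀ (N' : OpenNormalSubgroup Γ') (U₁ : OpenNormalSubgroup Γ) (y₁ : Γ'),
      φ ⁻¹' (U₁ : Set Γ) ⊆ N' → x⁻¹ * φ y₁ ∈ U₁ →
      (y₁ : Γ' ⧸ N'.toSubgroup) = (y (U N') : Γ' ⧸ N'.toSubgroup) := by
    intro N' U₁ y₁ hU₁ hy₁
    obtain ⟨U₃, -, hU₃⟩ := hΓ.basis ((U₁ : Set Γ) ∩ (U N' : Set Γ))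
      ((U₁.toOpenSubgroup.isOpen.inter (U N').toOpenSubgroup.isOpen).mem_nhds
        ⟨one_mem U₁, one_mem (U N')⟩)
    have key : ∀ (U₀ : OpenNormalSubgroup Γ) (y₀ : Γ'), φ ⁻¹' (U₀ : Set Γ) ⊆ N' →
        x⁻¹ * φ y₀ ∈ U₀ → (U₃ : Set Γ) ⊆ U₀ →
        (y₀ : Γ' ⧸ N'.toSubgroup) = (y U₃ : Γ' ⧸ N'.toSubgroup) := by
      intro U₀ y₀ hU₀ hy₀ h₃₀
      rw [QuotientGroup.eq]
      apply hU₀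
      show φ (y₀⁻¹ * y U₃) ∈ (U₀ : Set Γ)
      have hmem : (x⁻¹ * φ y₀)⁻¹ * (x⁻¹ * φ (y U₃)) ∈ U₀ :=
        mul_mem (inv_mem hy₀) (h₃₀ (hy U₃))
      simpa [map_mul, map_inv, mul_assoc] using hmem
    rw [key U₁ y₁ hU₁ hy₁ fun z hz => (hU₃ hz).1,
      key (U N') (y (U N')) (hU N') (hy (U N')) fun z hz => (hU₃ hz).2]
  -- completeness of `Γ′`: the compatible family of cosets comes from an element `g`
  obtain ⟨g, hg⟩ := hΓ'.complete (fun N' => (y (U N') : Γ' ⧸ N'.toSubgroup)) (by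
    intro N' M' hle g hgN'
    have h1 : (y (U N') : Γ' ⧸ M'.toSubgroup) = (y (U M') : Γ' ⧸ M'.toSubgroup) :=
      hW M' (U N') (y (U N')) (fun z hz => hle (hU N' hz)) (hy (U N'))
    rw [← h1]
    rw [QuotientGroup.eq] at hgN' ⊢
    exact hle hgN')
  -- `φ(g) = x`, since `x⁻¹ φ(g)` lies in every open normal subgroup of the separated group `Γ`
  refine ⟨g, ?_⟩
  have hall : ∀ U₀ : OpenNormalSubgroup Γ, x⁻¹ * φ g ∈ U₀ := by
    intro U₀
    let N' : OpenNormalSubgroup Γ' :=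
      { toOpenSubgroup := U₀.toOpenSubgroup.comap φ.toMonoidHom φ.continuous
        isNormal' := Subgroup.Normal.comap inferInstance _ }
    have hN' : φ ⁻¹' (U₀ : Set Γ) ⊆ N' := fun z hz => hz
    have h3 : (y U₀ : Γ' ⧸ N'.toSubgroup) = g := (hW N' U₀ (y U₀) hN' (hy U₀)).trans (hg N')
    rw [QuotientGroup.eq] at h3
    have h4 : φ ((y U₀)⁻¹ * g) ∈ U₀ := h3
    have h5 := mul_mem (hy U₀) h4
    simpa [map_mul, map_inv, mul_assoc] using h5
  by_contra hne
  obtain ⟨N, hN⟩ := hΓ.separated (x⁻¹ * φ g) fun h => hne (inv_mul_eq_one.mp h).symm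
  exact hN (hall N)

/-- **… hence a closed embedding: preimages of compact subgroups are compact** (Mathlib
`IsInducing.isCompact_preimage` with the closed range). [cite: MochizukiSemiAnbd2006, Def 3.1(i) p.33] -/
theorem IsTempered.isCompact_comap_of_isInducing (hΓ : IsTempered Γ) (hΓ' : IsTempered Γ')
    (φ : Γ' →ₜ* Γ) (hind : Topology.IsInducing φ) (K : Subgroup Γ) (hK : IsCompact (K : Set Γ)) :
    IsCompact ((K.comap φ.toMonoidHom : Subgroup Γ') : Set Γ') := by
  rw [Subgroup.coe_comap]
  exact hind.isCompact_preimage (hΓ.isClosed_range_of_isInducing hΓ' φ hind) hK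

end TemperedEmbedding

namespace ProfiniteSemiGraph

namespace TemperedPiChart

variable {𝒢 : ProfiniteSemiGraph.{u}} {c : TemperedPiChart 𝒢} {H : 𝒢.graph.Subgraph}

/-! ### Assembly: (P2) for decomposition homomorphisms that are topological embeddings -/

/-- **[IUTchI] Prop. 2.2, third inclusion, for a decomposition homomorphism inducing the topology of
`π₁^temp(𝒢_ℍ)`** (print, §2 p. 44 l. 39–44: the decomposition groups come with "[outer] inclusions … of
topological groups"): under Thm. 3.7's hypotheses for `𝒢` and `𝒢_ℍ` and Thm. 3.7 (iii) at `𝒢_ℍ`, every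
decomposition subgroup of `ℍ` is commensurably terminal in `π₁^temp(𝒢)`.
[cite: Mochizuki2012, IUTchI Prop 2.2 p.45] -/
theorem decompSubgroupsCommensurablyTerminal_of_isInducing (h37 : 𝒢.Thm37Hypotheses)
    (h37H : (𝒢.restrict H).Thm37Hypotheses) (hCIV : CompactInVerticialAt (𝒢.restrict H))
    {c' : TemperedPiChart (𝒢.restrict H)} {φ : c'.G →ₜ* c.G} (hφ : c.IsDecompHom H c' φ)
    (hind : Topology.IsInducing φ) : c.DecompSubgroupsCommensurablyTerminal H :=
  decompSubgroupsCommensurablyTerminal_of_isCompact_comap h37 h37H hCIV hφ fun K hK =>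
    c.isTempered.isCompact_comap_of_isInducing c'.isTempered φ hind K hK

/-- **The same for a FINITE sub-semi-graph `ℍ`**, where Thm. 3.7 (iii) at `𝒢_ℍ` is the tree's theorem
`compactInVerticialFin_holds`. [cite: Mochizuki2012, IUTchI Prop 2.2 p.45] -/
theorem decompSubgroupsCommensurablyTerminal_of_isInducing_of_finite
    [hV : Finite H.toSemiGraph.Vertex] [hE : Finite H.toSemiGraph.Edge] (h37 : 𝒢.Thm37Hypotheses)
    (h37H : (𝒢.restrict H).Thm37Hypotheses) {c' : TemperedPiChart (𝒢.restrict H)}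
    {φ : c'.G →ₜ* c.G} (hφ : c.IsDecompHom H c' φ) (hind : Topology.IsInducing φ) :
    c.DecompSubgroupsCommensurablyTerminal H :=
  decompSubgroupsCommensurablyTerminal_of_isInducing h37 h37H
    (@compactInVerticialFin_holds (𝒢.restrict H) hV hE) hφ hind

/-- Under the same embedding hypothesis the decomposition homomorphism is injective and its range — and
hence EVERY decomposition subgroup of `ℍ`, a conjugate of it — is CLOSED in `π₁^temp(𝒢)` (the tempered
half of [IUTchI] Cor. 2.3 (v)-type closedness, "closed subgroups" p. 47).
[cite: Mochizuki2012, IUTchI §2 p.44] -/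
theorem isClosed_of_mem_decompSubgroups_of_isInducing {c' : TemperedPiChart (𝒢.restrict H)}
    {φ : c'.G →ₜ* c.G} (hφ : c.IsDecompHom H c' φ) (hind : Topology.IsInducing φ) {D : Subgroup c.G}
    (hD : D ∈ c.decompSubgroups H) : Function.Injective φ ∧ IsClosed (D : Set c.G) := by
  haveI := c.isTopologicalGroup
  refine ⟨c'.isTempered.injective_of_isInducing φ hind, ?_⟩
  obtain ⟨g, rfl⟩ := exists_conj_of_mem_decompSubgroups hφ.range_mem hD
  have hcl : IsClosed ((φ.toMonoidHom.range : Subgroup c.G) : Set c.G) := by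
    rw [MonoidHom.coe_range]
    exact c.isTempered.isClosed_range_of_isInducing c'.isTempered φ hind
  have himg : ((φ.toMonoidHom.range.map (MulAut.conj g).toMonoidHom : Subgroup c.G) : Set c.G) =
      (fun x => x * g⁻¹) '' ((fun x => g * x) '' (φ.toMonoidHom.range : Set c.G)) := by
    rw [Set.image_image, Subgroup.coe_map]
    ext x
    simp [MulAut.conj_apply]
  rw [himg]
  exact (Homeomorph.mulRight g⁻¹).isClosedMap _ ((Homeomorph.mulLeft g).isClosedMap _ hcl)

end TemperedPiChart

end ProfiniteSemiGraph

end Literature.AnabelianGeometry.SemiGraphs
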